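import Summits.BirchSwinnertonDyer.BirchSwinnertonDyer.Theses.GenusKolyvaginAtTwo

/-!
# Route `GenusKolyvaginAtTwo`: the glue of the split of crux `KolyvaginExactAtTwo` (LINE 6)

Item stmt-BirchSwinnertonDyer-24884 (`KolyvaginExactAtTwoOfSplit`, support/glue of the gen-1 split of
crux stmt-BirchSwinnertonDyer-22137 `KolyvaginExactAtTwo` into items 24879–24883). Seat `bsd-line-gk2-p2`
g5 (cell `bsd-f1-sign2`). THEOREM-ONLY file (no definition, no named fact, no `sorry`).

The glue is pure logic: `EquivariantKolyvaginExactAtTwo` is, by definition, the implication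
«Q2 `KolyvaginRelationAtTwo` → Q5 `EquivariantChebotarevAtTwo` → Q1 (the cyclicity statement
`CyclicTorsionOfNegDisc`, displayed verbatim) → the parent crux on the regime `Δ(E) < 0`», and
`KolyvaginExactAtTwoPosDisc` is the parent crux on the regime `0 < Δ(E)`; an elliptic curve has `Δ ≠ 0`,
so the two regimes exhaust the parent `KolyvaginExactAtTwo`. BSD is not proved by any of this; the parent
crux is not proved by this file either (it closes the GLUE item only: children ⟹ parent).
-/

set_option autoImplicit false
set_option linter.dupNamespace false

namespace Summit.BirchSwinnertonDyer.BirchSwinnertonDyer.Theorems.GenusExact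

open Summit.BirchSwinnertonDyer.BirchSwinnertonDyer.Theses.GenusKolyvaginAtTwo

/-- **Glue of the LINE-6 split of `KolyvaginExactAtTwo`** (item stmt-BirchSwinnertonDyer-24884, by name):
`CyclicTorsionOfNegDisc → KolyvaginRelationAtTwo → EquivariantChebotarevAtTwo →
EquivariantKolyvaginExactAtTwo → KolyvaginExactAtTwoPosDisc → KolyvaginExactAtTwo`.
Proof: case on the sign of the (non-zero) discriminant `Δ(W)`; on `Δ < 0` feed Q2, Q5, Q1 to the key
child, on `0 < Δ` use the declared residual. [folklore] -/
theorem kolyvaginExactAtTwoOfSplit_proof : KolyvaginExactAtTwoOfSplit := by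
  intro hQ1 hQ2 hQ5 hQ3 hQ4 W _ _ _ hcm K _ _ hIQ hodd h3 hHe hsq1 hsq2 hρ Dt β ι d₁ hy M₀ hdiv hndiv n d hn
    hKoly hPn
  have hΔ : W.Δ ≠ 0 := by rw [← WeierstrassCurve.coe_Δ']; exact W.Δ'.ne_zero
  rcases lt_or_gt_of_ne hΔ with hneg | hpos
  · exact hQ3 hQ2 hQ5 hQ1 W hcm hneg K hIQ hodd h3 hHe hsq1 hsq2 hρ Dt β ι d₁ hy M₀ hdiv hndiv n d hn
      hKoly hPn
  · exact hQ4 W hcm hpos K hIQ hodd h3 hHe hsq1 hsq2 hρ Dt β ι d₁ hy M₀ hdiv hndiv n d hn hKoly hPn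

end Summit.BirchSwinnertonDyer.BirchSwinnertonDyer.Theorems.GenusExact
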